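import Literature.Topology.FourManifolds.DehnSurgeryTubularNbhdProofs
import Mathlib.Analysis.SpecialFunctions.SmoothTransition
import Mathlib.Analysis.Calculus.InverseFunctionTheorem.FDeriv
import HarnessLib

/-!
# Frames in `ℝ⁴`, normalised maps, local injectivity: toolkit for thickening a core arc to a band

Topic `Literature/Topology/FourManifolds` (trunk T-4MAN). Fact seat
`provefact-Literature.Topology.FourManifolds.Knot.exists_isBandSum` (`BandSum.lean`: existence of
band sums, R. E. Gompf, A. I. Stipsicz, *4-Manifolds and Kirby Calculus* (1999), §5.1).  The band
is the normalisation `A/‖A‖ : ℝ² → S³ ⊆ ℝ⁴` of a map `A : ℝ² → ℝ⁴` blended from three strips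
along an embedded core arc; this file collects the elementary linear algebra and calculus used to
show that such a map is an injective immersion on a thin strip about the core:

* row operations and multilinearity identities for the tree's `frameDet` (the determinant of four
  vectors of `ℝ⁴`, `DehnSurgeryTubularNbhdProofs.lean`): `frameDet_smul_row_one`,
  `frameDet_swap_smul`, `frameDet_row_two_add`, `frameDet_row_two_sub`, `frameDet_row_three_sub`,
  `frameDet_row_two_comb`, `frameDet_row_three_comb`, and `contDiff_frameDet`;
* `eq_zero_of_frameDet_ne_zero_four`, `linearIndependent_fin_three_of_frameDet_ne_zero`,
  `exists_eq_add_of_frameDet_eq_zero` — a nonzero determinant makes the four rows a basis; the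
  first three rows are linearly independent; a vector killed in the third and fourth slot against
  the first two rows lies in their span (**Cramer's rule**, in the form used to solve for a normal
  field with prescribed class modulo the tangent plane);
* `injective_fderiv_normalize` — if no nonzero `v` has `DF(x) v ∈ ℝ · F x`, the normalised map
  `F/‖F‖` has injective differential at `x`;
* `exists_nhds_injOn_of_injective_fderiv` — a `C¹` map with injective differential at `x` is
  injective near `x` (Hirsch (1976), Ch. 2 §1, Lemma 1.3; via Mathlib's
  `HasStrictFDerivAt.approximates_deriv_on_nhds` and the anti-Lipschitz bound of an injective
  linear map on a finite-dimensional space);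
* `exists_pos_Icc_prod_Ioo_subset` — an open subset of `ℝ × ℝ` containing `[a, b] × {0}`
  contains a uniform strip `[a, b] × (-η, η)`.

Everything here is proved; no named facts are introduced.

## References

* M. W. Hirsch, *Differential Topology*, GTM 33 (1976), Ch. 2 §1 (Lemma 1.3: immersions are
  locally injective, embeddings are stable), Ch. 4 §5 (tubular neighbourhoods). [HirschDT1976]
* R. E. Gompf, A. I. Stipsicz, *4-Manifolds and Kirby Calculus* (1999), §5.1 (the consumer).
  [GompfStipsicz1999]
-/

open scoped Topology ContDiff
open Function Set Filter Metric

noncomputable section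

namespace Literature.Topology.FourManifolds

/-! ### Row operations on `frameDet` -/

section FrameDet

/-- Scaling the second row scales `frameDet`. [folklore] -/
theorem frameDet_smul_row_one (r₀ r₁ r₂ r₃ : EuclideanSpace ℝ (Fin 4)) (a : ℝ) :
    frameDet r₀ (a • r₁) r₂ r₃ = a * frameDet r₀ r₁ r₂ r₃ := by
  rw [frameDet_expand, frameDet_expand]
  simp
  ring

/-- Exchanging the second and third rows, with scalings, changes the sign of `frameDet`.
[folklore] -/
theorem frameDet_swap_smul (r₀ r₁ r₂ r₃ : EuclideanSpace ℝ (Fin 4)) (a b : ℝ) :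
    frameDet r₀ (a • r₂) (b • r₁) r₃ = -(a * b) * frameDet r₀ r₁ r₂ r₃ := by
  rw [frameDet_expand, frameDet_expand]
  simp
  ring

/-- Adding multiples of the first two rows to the third row does not change `frameDet`.
[folklore] -/
theorem frameDet_row_two_add (r₀ r₁ r₂ r₃ : EuclideanSpace ℝ (Fin 4)) (s t : ℝ) :
    frameDet r₀ r₁ (r₂ + s • r₀ + t • r₁) r₃ = frameDet r₀ r₁ r₂ r₃ := by
  rw [frameDet_expand, frameDet_expand]
  simp
  ring

/-- Linearity of `frameDet` in the third row, against the third and fourth rows. [folklore] -/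
theorem frameDet_row_two_sub (r₀ r₁ r₂ r₃ v : EuclideanSpace ℝ (Fin 4)) (a b : ℝ) :
    frameDet r₀ r₁ (v - a • r₂ - b • r₃) r₃ = frameDet r₀ r₁ v r₃ - a * frameDet r₀ r₁ r₂ r₃ := by
  rw [frameDet_expand, frameDet_expand, frameDet_expand]
  simp
  ring

/-- Linearity of `frameDet` in the fourth row, against the third and fourth rows. [folklore] -/
theorem frameDet_row_three_sub (r₀ r₁ r₂ r₃ v : EuclideanSpace ℝ (Fin 4)) (a b : ℝ) :
    frameDet r₀ r₁ r₂ (v - a • r₂ - b • r₃) = frameDet r₀ r₁ r₂ v - b * frameDet r₀ r₁ r₂ r₃ := by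
  rw [frameDet_expand, frameDet_expand, frameDet_expand]
  simp
  ring

/-- `frameDet` of a combination of the four rows placed in the third slot picks out the third
coefficient. [folklore] -/
theorem frameDet_row_two_comb (r₀ r₁ r₂ r₃ : EuclideanSpace ℝ (Fin 4)) (a b c e : ℝ) :
    frameDet r₀ r₁ (a • r₀ + b • r₁ + c • r₂ + e • r₃) r₃ = c * frameDet r₀ r₁ r₂ r₃ := by
  rw [frameDet_expand, frameDet_expand]
  simp
  ring

/-- `frameDet` of a combination of the four rows placed in the fourth slot picks out the fourth
coefficient. [folklore] -/
theorem frameDet_row_three_comb (r₀ r₁ r₂ r₃ : EuclideanSpace ℝ (Fin 4)) (a b c e : ℝ) :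
    frameDet r₀ r₁ r₂ (a • r₀ + b • r₁ + c • r₂ + e • r₃) = e * frameDet r₀ r₁ r₂ r₃ := by
  rw [frameDet_expand, frameDet_expand]
  simp
  ring

/-- `frameDet` is `C^∞` in its four rows. [folklore] -/
theorem contDiff_frameDet {X : Type*} [NormedAddCommGroup X] [NormedSpace ℝ X] {n : WithTop ℕ∞}
    {r₀ r₁ r₂ r₃ : X → EuclideanSpace ℝ (Fin 4)} (h₀ : ContDiff ℝ n r₀) (h₁ : ContDiff ℝ n r₁)
    (h₂ : ContDiff ℝ n r₂) (h₃ : ContDiff ℝ n r₃) :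
    ContDiff ℝ n fun x ↦ frameDet (r₀ x) (r₁ x) (r₂ x) (r₃ x) := by
  have hc : ∀ {r : X → EuclideanSpace ℝ (Fin 4)}, ContDiff ℝ n r → ∀ i : Fin 4,
      ContDiff ℝ n fun x ↦ r x i :=
    fun hr i ↦ contDiff_euclidean.1 hr i
  simp only [frameDet_expand]
  fun_prop (disch := assumption)

/-- If `frameDet r₀ r₁ r₂ r₃ ≠ 0` then `r₀, r₁, r₂, r₃` are linearly independent (all four
coefficients of a vanishing linear combination vanish). [folklore] -/
theorem eq_zero_of_frameDet_ne_zero_four {r₀ r₁ r₂ r₃ : EuclideanSpace ℝ (Fin 4)}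
    (h : frameDet r₀ r₁ r₂ r₃ ≠ 0) {s t u v : ℝ} (h0 : s • r₀ + t • r₁ + u • r₂ + v • r₃ = 0) :
    s = 0 ∧ t = 0 ∧ u = 0 ∧ v = 0 := by
  by_contra hne
  apply h
  unfold frameDet
  rw [← Matrix.exists_vecMul_eq_zero_iff]
  refine ⟨![s, t, u, v], ?_, ?_⟩
  · intro h'
    apply hne
    refine ⟨?_, ?_, ?_, ?_⟩
    · simpa using congrFun h' 0
    · simpa using congrFun h' 1
    · simpa using congrFun h' 2
    · simpa using congrFun h' 3
  · funext j
    have := congrArg (fun x : EuclideanSpace ℝ (Fin 4) ↦ x j) h0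
    simp at this
    simp [Matrix.vecMul, dotProduct, Fin.sum_univ_succ]
    linarith

/-- If `frameDet u v t X ≠ 0` then the first three rows `u, v, t` are linearly independent.
[folklore] -/
theorem linearIndependent_fin_three_of_frameDet_ne_zero {u v t X : EuclideanSpace ℝ (Fin 4)}
    (h : frameDet u v t X ≠ 0) : LinearIndependent ℝ ![u, v, t] := by
  rw [Fintype.linearIndependent_iff]
  intro g hg i
  rw [Fin.sum_univ_three] at hg
  simp only [Matrix.cons_val_zero, Matrix.cons_val_one, Matrix.cons_val] at hg
  have hg' : g 0 • u + g 1 • v + g 2 • t + (0 : ℝ) • X = 0 := by rw [zero_smul, add_zero]; exact hg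
  obtain ⟨h0, h1, h2, -⟩ := eq_zero_of_frameDet_ne_zero_four h hg'
  fin_cases i <;> assumption

/-- **Cramer's rule, membership form.**  If `frameDet r₀ r₁ r₂ r₃ ≠ 0` and a vector `w` has
`frameDet r₀ r₁ w r₃ = 0` and `frameDet r₀ r₁ r₂ w = 0`, then `w` lies in the span of `r₀, r₁`.
[folklore] -/
theorem exists_eq_add_of_frameDet_eq_zero {r₀ r₁ r₂ r₃ w : EuclideanSpace ℝ (Fin 4)}
    (h : frameDet r₀ r₁ r₂ r₃ ≠ 0) (h2 : frameDet r₀ r₁ w r₃ = 0) (h3 : frameDet r₀ r₁ r₂ w = 0) :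
    ∃ a b : ℝ, w = a • r₀ + b • r₁ := by
  -- `r₀, …, r₃` is a basis: expand `w`
  have hli : LinearIndependent ℝ ![r₀, r₁, r₂, r₃] := by
    rw [Fintype.linearIndependent_iff]
    intro g hg i
    rw [Fin.sum_univ_four] at hg
    simp only [Matrix.cons_val_zero, Matrix.cons_val_one, Matrix.cons_val] at hg
    obtain ⟨h0, h1, h2', h3'⟩ := eq_zero_of_frameDet_ne_zero_four h hg
    fin_cases i <;> assumption
  have hspan : Submodule.span ℝ (Set.range ![r₀, r₁, r₂, r₃]) = ⊤ :=
    hli.span_eq_top_of_card_eq_finrank' (by simp)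
  have hw : w ∈ Submodule.span ℝ (Set.range ![r₀, r₁, r₂, r₃]) := by rw [hspan]; trivial
  obtain ⟨c, hc⟩ := (Submodule.mem_span_range_iff_exists_fun ℝ).1 hw
  rw [Fin.sum_univ_four] at hc
  simp only [Matrix.cons_val_zero, Matrix.cons_val_one, Matrix.cons_val] at hc
  -- the two determinants pick out `c 2` and `c 3`
  have hc2 : c 2 = 0 := by
    have := h2
    rw [← hc, frameDet_row_two_comb] at this
    exact (mul_eq_zero.1 this).resolve_right h
  have hc3 : c 3 = 0 := by
    have := h3
    rw [← hc, frameDet_row_three_comb] at this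
    exact (mul_eq_zero.1 this).resolve_right h
  refine ⟨c 0, c 1, ?_⟩
  rw [← hc, hc2, hc3, zero_smul, zero_smul, add_zero, add_zero]

/-- **Solving for a normal field (Cramer's rule).**  If `frameDet r₀ r₁ r₂ r₃ ≠ 0`, the vector
`v - w₁ r₂ - w₂ r₃` with `w₁ = frameDet r₀ r₁ v r₃ / d`, `w₂ = frameDet r₀ r₁ r₂ v / d`,
`d = frameDet r₀ r₁ r₂ r₃`, lies in the span of `r₀, r₁`. [folklore] -/
theorem exists_eq_add_cramer {r₀ r₁ r₂ r₃ : EuclideanSpace ℝ (Fin 4)} (h : frameDet r₀ r₁ r₂ r₃ ≠ 0)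
    (v : EuclideanSpace ℝ (Fin 4)) :
    ∃ a b : ℝ, v - (frameDet r₀ r₁ v r₃ / frameDet r₀ r₁ r₂ r₃) • r₂ -
      (frameDet r₀ r₁ r₂ v / frameDet r₀ r₁ r₂ r₃) • r₃ = a • r₀ + b • r₁ := by
  refine exists_eq_add_of_frameDet_eq_zero h ?_ ?_
  · rw [frameDet_row_two_sub, div_mul_cancel₀ _ h, sub_self]
  · rw [frameDet_row_three_sub, div_mul_cancel₀ _ h, sub_self]

end FrameDet

/-! ### The normalised map `F/‖F‖` -/

section Normalize

variable {E : Type*} [NormedAddCommGroup E] [NormedSpace ℝ E]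
  {V : Type*} [NormedAddCommGroup V] [InnerProductSpace ℝ V]

/-- **The normalised map is an immersion** where the differential of `F` meets the line `ℝ · F x`
only trivially: if `DF(x) v = μ F x` forces `v = 0`, then `D(F/‖F‖)(x)` is injective.
[folklore] -/
theorem injective_fderiv_normalize {F : E → V} {x : E} (hF : DifferentiableAt ℝ F x) (hx : F x ≠ 0)
    (h : ∀ (v : E) (μ : ℝ), fderiv ℝ F x v = μ • F x → v = 0) :
    Injective (fderiv ℝ (fun y ↦ ‖F y‖⁻¹ • F y) x) := by
  have hnorm : ‖F x‖ ≠ 0 := norm_ne_zero_iff.2 hx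
  have hN : DifferentiableAt ℝ (fun y ↦ ‖F y‖⁻¹) x := (hF.norm ℝ hx).inv hnorm
  rw [fderiv_fun_smul hN hF]
  refine (injective_iff_map_eq_zero _).2 fun v hv ↦ ?_
  have hv' : ‖F x‖⁻¹ • fderiv ℝ F x v + (fderiv ℝ (fun y ↦ ‖F y‖⁻¹) x v) • F x = 0 := by
    simpa using hv
  refine h v (-(‖F x‖ * fderiv ℝ (fun y ↦ ‖F y‖⁻¹) x v)) ?_
  have key : fderiv ℝ F x v = ‖F x‖ • (‖F x‖⁻¹ • fderiv ℝ F x v) := by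
    rw [smul_smul, mul_inv_cancel₀ hnorm, one_smul]
  rw [key, eq_neg_of_add_eq_zero_left hv']
  simp only [smul_neg, smul_smul, neg_smul]

end Normalize

/-! ### Local injectivity of immersions -/

section LocalInjectivity

variable {E : Type*} [NormedAddCommGroup E] [NormedSpace ℝ E] [FiniteDimensional ℝ E]
  {F : Type*} [NormedAddCommGroup F] [NormedSpace ℝ F]

/-- **An immersion is locally injective** (Hirsch (1976), Ch. 2 §1, Lemma 1.3): if `f` is
strictly differentiable at `x` (e.g. `C¹` near `x`) with injective differential, then `f` is
injective on a neighbourhood of `x`: the differential is bounded below by `m‖·‖` on the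
finite-dimensional source, and `f` approximates it to within `(m/2)‖·‖` near `x`.
[cite: HirschDT1976, Ch. 2 §1 Lemma 1.3] -/
theorem exists_nhds_injOn_of_injective_fderiv {f : E → F} {f' : E →L[ℝ] F} {x : E}
    (hf : HasStrictFDerivAt f f' x) (hinj : Injective f') : ∃ U ∈ 𝓝 x, InjOn f U := by
  obtain ⟨K, hK, hanti⟩ := (LinearMap.injective_iff_antilipschitz (f' : E →ₗ[ℝ] F)).1 hinj
  have hKpos : (0 : ℝ) < K := by exact_mod_cast hK
  -- `f` approximates `f'` with constant `c = 1/(2K)` near `x`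
  set c : NNReal := ⟨(2 * K : ℝ)⁻¹, by positivity⟩ with hc
  have hcpos : (0 : NNReal) < c := by
    rw [hc, ← NNReal.coe_pos]
    change (0 : ℝ) < (2 * K : ℝ)⁻¹
    positivity
  obtain ⟨s, hs, happ⟩ := hf.approximates_deriv_on_nhds (c := c) (Or.inr hcpos)
  refine ⟨s, hs, fun y hy z hz hyz ↦ ?_⟩
  have h1 := happ y hy z hz
  rw [hyz, sub_self, zero_sub, norm_neg] at h1
  have h2 : ‖y - z‖ ≤ K * ‖f' (y - z)‖ := ZeroHomClass.bound_of_antilipschitz f' hanti (y - z)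
  have h3 : ‖(f' : E →L[ℝ] F) (y - z)‖ ≤ (2 * K : ℝ)⁻¹ * ‖y - z‖ := h1
  have h4 : ‖y - z‖ ≤ K * ((2 * K : ℝ)⁻¹ * ‖y - z‖) := h2.trans (by gcongr)
  have h5 : K * ((2 * K : ℝ)⁻¹ * ‖y - z‖) = ‖y - z‖ / 2 := by
    field_simp
  rw [h5] at h4
  have h6 : ‖y - z‖ = 0 := by linarith [norm_nonneg (y - z)]
  rwa [norm_eq_zero, sub_eq_zero] at h6

end LocalInjectivity

/-! ### Uniform strips about a compact segment -/

section Strip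

/-- **An open set of `ℝ × ℝ` containing `[a, b] × {0}` contains a uniform strip
`[a, b] × (-η, η)`** (tube lemma). [folklore] -/
theorem exists_pos_Icc_prod_Ioo_subset {a b : ℝ} {U : Set (ℝ × ℝ)} (hU : IsOpen U)
    (h : Icc a b ×ˢ ({0} : Set ℝ) ⊆ U) : ∃ η > 0, Icc a b ×ˢ Ioo (-η) η ⊆ U := by
  obtain ⟨u, v, -, hv, hau, h0v, huv⟩ :=
    generalized_tube_lemma isCompact_Icc isCompact_singleton hU h
  obtain ⟨η, hη, hball⟩ := Metric.isOpen_iff.1 hv 0 (h0v rfl)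
  refine ⟨η, hη, fun p hp ↦ huv ⟨hau hp.1, hball ?_⟩⟩
  rw [Metric.mem_ball, Real.dist_eq, sub_zero, abs_lt]
  exact hp.2

/-- A property of points of `ℝ × ℝ` which holds on an open set and along `[a, b] × {0}` holds on
a uniform strip `[a, b] × (-η, η)`. [folklore] -/
theorem exists_pos_forall_Icc_of_isOpen {a b : ℝ} {P : ℝ × ℝ → Prop} (hP : IsOpen {p | P p})
    (h : ∀ x ∈ Icc a b, P (x, 0)) :
    ∃ η > 0, ∀ x ∈ Icc a b, ∀ s ∈ Ioo (-η) η, P (x, s) := by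
  obtain ⟨η, hη, hsub⟩ := exists_pos_Icc_prod_Ioo_subset hP (by
    rintro ⟨x, s⟩ ⟨hx, hs⟩
    rw [mem_singleton_iff] at hs
    subst hs
    exact h x hx)
  exact ⟨η, hη, fun x hx s hs ↦ hsub ⟨hx, hs⟩⟩

end Strip

/-! ### Interpolating nonvanishing planar fields -/

section Interpolate

/-- **Interpolation of nonvanishing planar vector fields.**  Let `f, g : ℝ → ℝ²` be `C^∞` with
`f a ≠ 0`, `g b ≠ 0`, `a < b`.  Then there is a `C^∞` field `w` which is `f` on `(-∞, a]`, `g`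
on `[b, ∞)`, and nonvanishing on `[a, b]`: blend `f` into the constant `f a`, turn and stretch
`f a` into `g b` through polar coordinates, and blend into `g` (the connectedness of `ℝ² ∖ 0`).
[folklore] -/
theorem exists_contDiff_interpolate_ne_zero {f g : ℝ → EuclideanSpace ℝ (Fin 2)}
    (hf : ContDiff ℝ ∞ f) (hg : ContDiff ℝ ∞ g) {a b : ℝ} (hab : a < b) (hfa : f a ≠ 0)
    (hgb : g b ≠ 0) :
    ∃ w : ℝ → EuclideanSpace ℝ (Fin 2), ContDiff ℝ ∞ w ∧ (∀ x ≤ a, w x = f x) ∧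
      (∀ x, b ≤ x → w x = g x) ∧ ∀ x ∈ Icc a b, w x ≠ 0 := by
  set v₁ := f a with hv₁
  set v₂ := g b with hv₂
  have hr₁ : 0 < ‖v₁‖ := norm_pos_iff.2 hfa
  have hr₂ : 0 < ‖v₂‖ := norm_pos_iff.2 hgb
  -- ### continuity margins
  obtain ⟨ε, hε, hε4, hfε, hgε⟩ : ∃ ε : ℝ, 0 < ε ∧ 4 * ε < b - a ∧
      (∀ x, |x - a| ≤ ε → ‖f x - v₁‖ < ‖v₁‖ / 2) ∧ (∀ x, |x - b| ≤ ε → ‖g x - v₂‖ < ‖v₂‖ / 2) := by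
    have h1 : ∀ᶠ x in 𝓝 a, ‖f x - v₁‖ < ‖v₁‖ / 2 := by
      have := (hf.continuous.tendsto a).sub_const v₁ |>.norm
      rw [hv₁, sub_self, norm_zero] at this
      exact this.eventually (gt_mem_nhds (half_pos hr₁))
    have h2 : ∀ᶠ x in 𝓝 b, ‖g x - v₂‖ < ‖v₂‖ / 2 := by
      have := (hg.continuous.tendsto b).sub_const v₂ |>.norm
      rw [hv₂, sub_self, norm_zero] at this
      exact this.eventually (gt_mem_nhds (half_pos hr₂))
    obtain ⟨ε₁, hε₁, hball₁⟩ := Metric.eventually_nhds_iff.1 h1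
    obtain ⟨ε₂, hε₂, hball₂⟩ := Metric.eventually_nhds_iff.1 h2
    refine ⟨min (min (ε₁ / 2) (ε₂ / 2)) ((b - a) / 8), lt_min (lt_min (by positivity)
      (by positivity)) (by linarith), ?_, fun x hx => hball₁ ?_, fun x hx => hball₂ ?_⟩
    · have : min (min (ε₁ / 2) (ε₂ / 2)) ((b - a) / 8) ≤ (b - a) / 8 := min_le_right _ _
      linarith
    · rw [Real.dist_eq]
      have : min (min (ε₁ / 2) (ε₂ / 2)) ((b - a) / 8) ≤ ε₁ / 2 :=
        (min_le_left _ _).trans (min_le_left _ _)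
      linarith
    · rw [Real.dist_eq]
      have : min (min (ε₁ / 2) (ε₂ / 2)) ((b - a) / 8) ≤ ε₂ / 2 :=
        (min_le_left _ _).trans (min_le_right _ _)
      linarith
  -- ### polar forms of `v₁`, `v₂`
  obtain ⟨φ₁, hφ₁⟩ : ∃ φ : ℝ, ‖v₁‖ • ((circlePoint φ : Metric.sphere (0 : EuclideanSpace ℝ (Fin 2)) 1) :
      EuclideanSpace ℝ (Fin 2)) = v₁ := by
    have hu : ‖v₁‖⁻¹ • v₁ ∈ Metric.sphere (0 : EuclideanSpace ℝ (Fin 2)) 1 := by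
      rw [mem_sphere_zero_iff_norm, norm_smul, norm_inv, norm_norm, inv_mul_cancel₀ hr₁.ne']
    obtain ⟨φ, hφ⟩ := circlePoint_surjective ⟨_, hu⟩
    refine ⟨φ, ?_⟩
    rw [hφ]
    change ‖v₁‖ • (‖v₁‖⁻¹ • v₁) = v₁
    rw [smul_smul, mul_inv_cancel₀ hr₁.ne', one_smul]
  obtain ⟨φ₂, hφ₂⟩ : ∃ φ : ℝ, ‖v₂‖ • ((circlePoint φ : Metric.sphere (0 : EuclideanSpace ℝ (Fin 2)) 1) :
      EuclideanSpace ℝ (Fin 2)) = v₂ := by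
    have hu : ‖v₂‖⁻¹ • v₂ ∈ Metric.sphere (0 : EuclideanSpace ℝ (Fin 2)) 1 := by
      rw [mem_sphere_zero_iff_norm, norm_smul, norm_inv, norm_norm, inv_mul_cancel₀ hr₂.ne']
    obtain ⟨φ, hφ⟩ := circlePoint_surjective ⟨_, hu⟩
    refine ⟨φ, ?_⟩
    rw [hφ]
    change ‖v₂‖ • (‖v₂‖⁻¹ • v₂) = v₂
    rw [smul_smul, mul_inv_cancel₀ hr₂.ne', one_smul]
  -- ### the turning field `R`
  set S : ℝ → ℝ := fun x => Real.smoothTransition ((x - (a + ε)) / (b - a - 2 * ε)) with hS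
  have hSs : ContDiff ℝ ∞ S :=
    Real.smoothTransition.contDiff.comp ((contDiff_id.sub contDiff_const).div_const _)
  have hS0 : ∀ x ≤ a + ε, S x = 0 := fun x hx =>
    Real.smoothTransition.zero_of_nonpos (div_nonpos_of_nonpos_of_nonneg (by linarith) (by linarith))
  have hS1 : ∀ x, b - ε ≤ x → S x = 1 := fun x hx => by
    apply Real.smoothTransition.one_of_one_le
    rw [le_div_iff₀ (by linarith)]
    linarith
  set ρ : ℝ → ℝ := fun x => ‖v₁‖ + (‖v₂‖ - ‖v₁‖) * S x with hρ
  set φ : ℝ → ℝ := fun x => φ₁ + (φ₂ - φ₁) * S x with hφ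
  set R : ℝ → EuclideanSpace ℝ (Fin 2) := fun x =>
    ρ x • ((circlePoint (φ x) : Metric.sphere (0 : EuclideanSpace ℝ (Fin 2)) 1) :
      EuclideanSpace ℝ (Fin 2)) with hR
  have hρs : ContDiff ℝ ∞ ρ := contDiff_const.add (contDiff_const.mul hSs)
  have hφs : ContDiff ℝ ∞ φ := contDiff_const.add (contDiff_const.mul hSs)
  have hRs : ContDiff ℝ ∞ R := hρs.smul (contDiff_coe_circlePoint.comp hφs)
  have hρpos : ∀ x, 0 < ρ x := fun x => by
    have h0 : 0 ≤ S x := Real.smoothTransition.nonneg _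
    have h1 : S x ≤ 1 := Real.smoothTransition.le_one _
    change 0 < ‖v₁‖ + (‖v₂‖ - ‖v₁‖) * S x
    rcases le_or_gt (S x) (1 / 2) with h | h
    · nlinarith [mul_nonneg h0 hr₂.le]
    · nlinarith [mul_nonneg (sub_nonneg.2 h1) hr₁.le]
  have hRne : ∀ x, R x ≠ 0 := fun x => by
    rw [← norm_ne_zero_iff, hR]
    change ‖ρ x • ((circlePoint (φ x) : Metric.sphere (0 : EuclideanSpace ℝ (Fin 2)) 1) :
      EuclideanSpace ℝ (Fin 2))‖ ≠ 0
    rw [norm_smul, norm_eq_of_mem_sphere, mul_one, Real.norm_eq_abs, abs_of_pos (hρpos x)]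
    exact (hρpos x).ne'
  have hRleft : ∀ x ≤ a + ε, R x = v₁ := fun x hx => by
    change ρ x • _ = v₁
    have : ρ x = ‖v₁‖ := by change ‖v₁‖ + (‖v₂‖ - ‖v₁‖) * S x = ‖v₁‖; rw [hS0 x hx]; ring
    rw [this]
    have hφx : φ x = φ₁ := by change φ₁ + (φ₂ - φ₁) * S x = φ₁; rw [hS0 x hx]; ring
    rw [hφx, hφ₁]
  have hRright : ∀ x, b - ε ≤ x → R x = v₂ := fun x hx => by
    change ρ x • _ = v₂
    have : ρ x = ‖v₂‖ := by change ‖v₁‖ + (‖v₂‖ - ‖v₁‖) * S x = ‖v₂‖; rw [hS1 x hx]; ring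
    rw [this]
    have hφx : φ x = φ₂ := by change φ₁ + (φ₂ - φ₁) * S x = φ₂; rw [hS1 x hx]; ring
    rw [hφx, hφ₂]
  -- ### the two blending functions
  set α : ℝ → ℝ := fun x => 1 - Real.smoothTransition ((x - a) / ε) with hα
  set β : ℝ → ℝ := fun x => Real.smoothTransition ((x - (b - ε)) / ε) with hβ
  have hαs : ContDiff ℝ ∞ α :=
    contDiff_const.sub (Real.smoothTransition.contDiff.comp
      ((contDiff_id.sub contDiff_const).div_const _))
  have hβs : ContDiff ℝ ∞ β :=
    Real.smoothTransition.contDiff.comp ((contDiff_id.sub contDiff_const).div_const _)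
  have hα1 : ∀ x ≤ a, α x = 1 := fun x hx => by
    change 1 - Real.smoothTransition ((x - a) / ε) = 1
    rw [Real.smoothTransition.zero_of_nonpos (div_nonpos_of_nonpos_of_nonneg (by linarith) hε.le)]
    ring
  have hα0 : ∀ x, a + ε ≤ x → α x = 0 := fun x hx => by
    change 1 - Real.smoothTransition ((x - a) / ε) = 0
    rw [Real.smoothTransition.one_of_one_le (by rw [le_div_iff₀ hε]; linarith)]
    ring
  have hβ0 : ∀ x ≤ b - ε, β x = 0 := fun x hx =>
    Real.smoothTransition.zero_of_nonpos (div_nonpos_of_nonpos_of_nonneg (by linarith) hε.le)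
  have hβ1 : ∀ x, b ≤ x → β x = 1 := fun x hx =>
    Real.smoothTransition.one_of_one_le (by rw [le_div_iff₀ hε]; linarith)
  have hα01 : ∀ x, 0 ≤ α x ∧ α x ≤ 1 := fun x =>
    ⟨by change 0 ≤ 1 - _; linarith [Real.smoothTransition.le_one ((x - a) / ε)],
      by change 1 - _ ≤ 1; linarith [Real.smoothTransition.nonneg ((x - a) / ε)]⟩
  have hβ01 : ∀ x, 0 ≤ β x ∧ β x ≤ 1 := fun x =>
    ⟨Real.smoothTransition.nonneg _, Real.smoothTransition.le_one _⟩
  -- ### the interpolating field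
  set w : ℝ → EuclideanSpace ℝ (Fin 2) := fun x => α x • f x + β x • g x + (1 - α x - β x) • R x
    with hw
  refine ⟨w, ?_, fun x hx => ?_, fun x hx => ?_, fun x hx => ?_⟩
  · exact ((hαs.smul hf).add (hβs.smul hg)).add ((contDiff_const.sub hαs |>.sub hβs).smul hRs)
  · change α x • f x + β x • g x + (1 - α x - β x) • R x = f x
    rw [hα1 x hx, hβ0 x (by linarith)]
    simp
  · change α x • f x + β x • g x + (1 - α x - β x) • R x = g x
    rw [hα0 x (by linarith), hβ1 x hx]
    simp
  · change α x • f x + β x • g x + (1 - α x - β x) • R x ≠ 0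
    rcases le_or_gt x (a + ε) with hxa | hxa
    · -- left blending zone: `w = v₁ + α (f - v₁)`
      rw [hβ0 x (by linarith), hRleft x hxa, zero_smul, add_zero]
      have heq : α x • f x + (1 - α x - 0) • v₁ = v₁ + α x • (f x - v₁) := by
        simp only [sub_zero, sub_smul, one_smul, smul_sub]; abel
      rw [heq]
      intro h0
      have h1 : ‖α x • (f x - v₁)‖ < ‖v₁‖ := by
        rw [norm_smul, Real.norm_eq_abs, abs_of_nonneg (hα01 x).1]
        have := hfε x (by rw [abs_le]; exact ⟨by linarith [hx.1], by linarith⟩)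
        calc α x * ‖f x - v₁‖ ≤ 1 * ‖f x - v₁‖ := by gcongr; exact (hα01 x).2
          _ < ‖v₁‖ := by linarith
      have h2 : v₁ = -(α x • (f x - v₁)) := eq_neg_of_add_eq_zero_left h0
      have h3 := congrArg (fun z : EuclideanSpace ℝ (Fin 2) => ‖z‖) h2
      simp only [norm_neg] at h3
      linarith
    · rcases lt_or_ge x (b - ε) with hxb | hxb
      · -- middle: `w = R`
        rw [hα0 x hxa.le, hβ0 x hxb.le]
        simpa using hRne x
      · -- right blending zone: `w = v₂ + β (g - v₂)`
        rw [hα0 x hxa.le, hRright x hxb, zero_smul, zero_add]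
        have heq : β x • g x + (1 - 0 - β x) • v₂ = v₂ + β x • (g x - v₂) := by
          simp only [sub_zero, sub_smul, one_smul, smul_sub]; abel
        rw [heq]
        intro h0
        have h1 : ‖β x • (g x - v₂)‖ < ‖v₂‖ := by
          rw [norm_smul, Real.norm_eq_abs, abs_of_nonneg (hβ01 x).1]
          have := hgε x (by rw [abs_le]; exact ⟨by linarith, by linarith [hx.2]⟩)
          calc β x * ‖g x - v₂‖ ≤ 1 * ‖g x - v₂‖ := by gcongr; exact (hβ01 x).2
            _ < ‖v₂‖ := by linarith
        have h2 : v₂ = -(β x • (g x - v₂)) := eq_neg_of_add_eq_zero_left h0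
        have h3 := congrArg (fun z : EuclideanSpace ℝ (Fin 2) => ‖z‖) h2
        simp only [norm_neg] at h3
        linarith

end Interpolate

end Literature.Topology.FourManifolds
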